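import Summits.BirchSwinnertonDyer.BirchSwinnertonDyer.Theses.PrintCf2RubinValueTwo
import Literature.NumberTheory.EllipticCurves.CongruentNumberEvenMonskySelmerExact
import HarnessLib

/-!
# Route `PrintCf2RubinValueTwo`, aside stmt-BirchSwinnertonDyer-23768 `HBMonskySelmerEven` — CLOSED by the
# tree's discharge `HeathBrown1994.monsky_card_selmerGroup_two_even_holds`

Route `PrintCf2RubinValueTwo` (leaf CornerF @ `p = 2`), aside r9 `HBMonskySelmerEven` (stmt-BirchSwinnertonDyer-23768):
the route-level alias of the named fact `Literature.NumberTheory.EllipticCurves.HeathBrown1994.monsky_card_selmerGroup_two_even`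
(Heath-Brown 1994, Invent. 118, Appendix by Monsky, EVEN case: `#Sel₂(E_{2m})/E[2] = 2^{2k − rank M}`), item-stated BY
NAME so that the route's cite-only dependency is an own registered obligation — the SAME decl body as route `PrintCf2`'s
aside `HBMonskySelmerEven` (stmt-BirchSwinnertonDyer-20588, CLOSED · proved by `Theorems/PrintCf2HBMonskySelmerEven.lean`).
The fact is a THEOREM of the tree (`HeathBrown1994.monsky_card_selmerGroup_two_even_holds`, cell `bsd-monsky`, complete
`2`-descent, `Literature/NumberTheory/EllipticCurves/CongruentNumberEvenMonskySelmerExact.lean`), so this route's copy of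
the item closes by the same one-line term (seat `bsd-wall-tp2-p2x` g20, housekeeping sweep of alias items whose facts are
already discharged).  THEOREMS ONLY; nothing new asserted; BSD is not proved by any of this.
[cite: HeathBrown1994SelmerCongruentII, Appendix (Monsky), typescript p. 41 L20–L36]
-/

noncomputable section

set_option autoImplicit false
-- `Summit.BirchSwinnertonDyer.BirchSwinnertonDyer.Theorems` is the layout's namespace (Sub = Summit name).
set_option linter.dupNamespace false

namespace Summit.BirchSwinnertonDyer.BirchSwinnertonDyer.Theorems

/-- **Aside 23768 of route `PrintCf2RubinValueTwo` holds**: Monsky's even-case Selmer count is the tree theorem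
`HeathBrown1994.monsky_card_selmerGroup_two_even_holds`.
[cite: HeathBrown1994SelmerCongruentII, Appendix (Monsky), typescript p. 41 L20–L36] -/
theorem printCf2RubinValueTwo_hbMonskySelmerEven_proof :
    Summit.BirchSwinnertonDyer.BirchSwinnertonDyer.Theses.PrintCf2RubinValueTwo.HBMonskySelmerEven :=
  Literature.NumberTheory.EllipticCurves.HeathBrown1994.monsky_card_selmerGroup_two_even_holds

end Summit.BirchSwinnertonDyer.BirchSwinnertonDyer.Theorems

end
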